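import Literature.InformationTheory.QuantumCodes.ClusterCountingBound
import Literature.InformationTheory.QuantumCodes.MinWeightDecodingClusters
import Literature.InformationTheory.QuantumCodes.SyndromeDecoding
import Literature.InformationTheory.QuantumCodes.CSS
import Literature.Probability.LatticeModels.LatticeGraph
import Literature.Probability.RandomPlanarGeometry.SelfAvoidingWalk
import Mathlib.Analysis.SpecificLimits.Basic
import HarnessLib

/-!
# The toric code under independent bit-flip noise: minimum-weight decoding and the
# Dennis–Kitaev–Landahl–Preskill counting-bound threshold (perfect syndrome measurement)

Topic `Literature/InformationTheory/QuantumCodes` (venture QEC, LADDER-QEC rung Q5, PARTITION row 09;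
director-qec DIRECTION D4/D4″ 2026-08-26). Column words: DEFINITION (the lattice, the code, the
decoding problem, the failure probability — all computable / decidable data over `ZMod 2`),
PROVED (`starRow_dotProduct_plaquetteRow`: stars and plaquettes commute, i.e. `∂∂ = 0`), and
STATEMENT-ONLY named facts `def … : Prop` (the printed threshold bound, to be discharged by the
Q5 provers as `…_holds`). No numerical threshold is asserted as a theorem here; the printed value
`p_c ≥ .0373` is a CLAIM recorded in a docstring (see below) and nowhere else.

**The objects** (Dennis et al. 2002 §3.1–3.2, after Kitaev): an `L × L` square lattice on the
torus, vertices `ℤ_L × ℤ_L` (`Vertex L`, the tree's `TorusSite 2 L`), qubits on the `2L²` links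
(`Edge L = Vertex L × Fin 2`, the link `(v, i)` joining `v` to `v + eᵢ`; this indexing is faithful
to the multigraph for every `L ≥ 1`, including the double links of `L = 2` and the loops of
`L = 1`). The stabilizer generators are the site operators `X_s = ⊗_{ℓ ∋ s} X` (`starRow s`, the
four link slots at `s`) and the plaquette operators `Z_P = ⊗_{ℓ ∈ ∂P} Z` (`plaquetteRow P`); as
binary check matrices `starMatrix L` (`X`-type) and `plaquetteMatrix L` (`Z`-type) they commute
(`starMatrix_mul_plaquetteMatrix_transpose`, PROVED), giving the CSS code `toricCode L`
(`CSSCode` of `CSS.lean`). One error type is analysed at a time ("we have separate procedures for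
recovery from the X errors and the Z errors", §4.1); here: `Z`-errors `e : Chain L = Edge L → ZMod 2`
(1-chains mod 2), whose syndrome is the set of sites with `X_s = -1`, i.e. the BOUNDARY
`∂e = starMatrix L *ᵥ e` (`syn`; "the measured syndrome `S` reveals the boundary of the error chain",
§4.3); recovery applies a chain `e'` with the same boundary and "succeeds if `E + E'` is
homologically trivial (the boundary of a surface)", i.e. lies in the span of the plaquette
boundaries (`boundaries L = rowSpace (plaquetteMatrix L)`), "and fails otherwise" (§4.3). By the
self-duality of the square lattice the `X`-error problem is the same problem on the dual lattice.

**The decoder** (§5.1): "we select from among all error chains that have the same boundary as the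
syndrome chain `S`, the single chain `E_min` that has the highest probability", i.e. (for `q = 0`,
`p < 1/2`) the minimal number of links; "If the minimal chain is not unique, one of the minimal
chains is selected" — so the results hold for EVERY minimum-weight decoder, rendered by the
tree's `Decoder.IsMinWeight` (`SyndromeDecoding.lean`) for the syndrome map `syn L`, the
undetectable errors `cycles L` and the weight `hammingNorm`; the minimal chain "can be computed in
a time polynomial in `L` using the perfect matching algorithm of Edmonds" (§4.7/§5.1: this is the
MWPM decoder at code-capacity level). **The noise** (§4.1, §4.4 with `q = 0`): each link suffers a
`Z` error independently with probability `p`, `prob(E) = p^{|E|}(1-p)^{2L²-|E|}` — the tree's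
`bernoulliWeight` (`ClusterCountingBound.lean`) of the support. `failureProb L D p` is the total
probability of the chains on which `D` fails.

**The threshold bound** (§5.2–5.3, perfect measurement, eq. (saw_L) with `V = 0`, `T = 1`, and
eqs. (threshold_2d)–(p_c_2d)): failure forces `E + E_min` to contain a homologically non-trivial
self-avoiding polygon with `H ≥ L` links, at least half of them in `E` (eq. (e_ineq)), whence
`Prob_fail ≤ L² Σ_{H ≥ L} n_SAP(H) (4p̃)^{H/2}`, `p̃ = p(1-p)`, and `Prob_fail → 0` as `L → ∞` as
soon as the polygon counts grow at most like `ν^H` with `4ν² p̃ < 1`. Following director-qec D4″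
(and qec-ref-3's tier analysis) the count hypothesis is typed in PER-LENGTH EXPONENTIAL FORM on the
number `cₙ` of `n`-step self-avoiding walks on `ℤ²` from the origin — the tree's
`Literature.Probability.RandomPlanarGeometry.SAW.count`, taken BY NAME (`SAWCountBound C ν :
∀ n, cₙ ≤ C ν^n`; inside the proof a rooted polygon with `H` links on the torus yields an
`(H-1)`-step SAW of `ℤ²` by lifting, so `n_SAP(H) ≤ (#links) · c_{H-1}` for `L ≥ 3`) — NOT in
DKLP's polynomial-prefactor form `P₂(ℓ) μ₂^ℓ` (eq. (saw_2); that form is an open problem for the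
true `μ₂`). ONE parametric statement, `toricThreshold_of_sawCountBound`: for every `C, ν` with
`SAWCountBound C ν`, every family of minimum-weight decoders and every `0 ≤ p ≤ 1/2` with
`4 ν² p(1-p) < 1`, `failureProb (L+1) (D L) p → 0`. Its INSTANCES are Summits-side corollaries by
import (`Summits/Ventures/QEC/Thresholds/`), each with its trust tier: `ν = 3`
(`SAW.Zd.count_succ_le`, eq. (saw_d): `p < (3-2√2)/6 ≈ .0286`, CERTIFIED), `ν = 26^{1/3}`
(`SAW.Zd.count_le_two_mul_mul_memFourConst_pow`: `p < .0293`, CERTIFIED), `ν = 2.688`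
(`SAW.FiniteMemory.count_mul_pow_le_of_checkC` + `checkC_18_2688`, `native_decide`: `p < .0358`,
CHECKED-native), every `ν > 2.679193` given the named fact
`SAW.Zd.BDGS2012_connectiveConstant_two_bounds` and `SAW.Zd.tendsto_count_rpow` (`p < .0361`,
CERTIFIED-conditional). CLAIM, not typed as a statement anywhere: the printed "`p̃ < (4μ₂²)⁻¹ ≈
(27.8)⁻¹ = .0359`, or `p < .0373`" (eqs. (threshold_2d)–(p_c_2d)) plugs in the NUMERICAL estimate
`μ₂ ≈ 2.638` of the connective constant and is therefore not certifiable as printed (qec-ref-3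
FINDING 2026-08-26T15:11:57Z; ref/REFEREE-BUNDLE.md §5).

Also typed (STATEMENT-ONLY): `cycle_weight_ge` — "the homologically nontrivial (self-avoiding)
path must contain at least `L` links" (§5.2), i.e. `d_Z(toric) ≥ L`, the input that ALSO feeds the
tree's generic LDPC counting bound `sum_decodingFails_le` (`LDPCCountingThreshold.lean`, check
graph of degree `≤ 6`) for a (much weaker, `p₀ = 1/5184`) threshold by a different route.

Deliberately NOT here: the proofs of the two named facts (Q5 items); the phenomenological case
`q > 0` (3D lattice, eq. (saw_L) with `V > 0`; the counting inputs `μ₃` are in the tree: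
`SAW.Zd.connectiveConstant_three_le_476`); planar codes ("relative polygons … no effect on the
estimate", §5.3); the optimal (free-energy) decoder and the Nishimori-line value `p_c ≈ .1094`
(§4.6, NUMERICAL); any Monte Carlo number; generic threshold vocabulary (`CodeCapacityNoise.lean`).

## References (read)

* [DennisEtAl2002] E. Dennis, A. Kitaev, A. Landahl, J. Preskill, *Topological quantum memory*,
  J. Math. Phys. 43 (2002) 4452–4505, arXiv:quant-ph/0110143 (held `paper:arxiv-quant-ph_0110143`):
  §3.1–3.2 (toric code: links, site operators `X_s`, plaquette operators `Z_P`), §4.1 (error model),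
  §4.3 (syndrome = boundary; success iff `E + E'` homologically trivial), §5.1 (minimum-weight chain,
  Edmonds matching), §5.2 (eqs. (e_ineq), (saw_prob), (saw_L); "at least `L` links"), §5.3
  (eqs. (saw_d), (saw_2), (threshold_2d), (p_c_2d): `p < .0373`).
* [Kitaev2003] A. Yu. Kitaev, *Fault-tolerant quantum computation by anyons*, Ann. Phys. 303 (2003)
  2–30, §2 (the toric code) — cited through DKLP §3.
-/

namespace Literature.InformationTheory.QuantumCodes

open Finset Filter Topology Matrix
open Literature.Probability.LatticeModels (TorusSite)
open Literature.Probability.RandomPlanarGeometry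

namespace ToricCode

variable (L : ℕ)

/-! ### The lattice: sites, links, chains -/

/-- The sites of the `L × L` square lattice on the torus, `ℤ_L × ℤ_L` (the tree's discrete torus
`TorusSite 2 L = Fin 2 → ZMod L`). [cite: DennisEtAl2002, §3.1 (L × L square lattice on the torus)] -/
abbrev Vertex : Type := TorusSite 2 L

/-- The links (= qubits) of the toric lattice: `(v, i)` is the link from the site `v` to
`v + eᵢ`, `i ∈ {0, 1}`; there are `2L²` of them. [cite: DennisEtAl2002, §3.1 (qubits on the 2L² links)] -/
abbrev Edge : Type := TorusSite 2 L × Fin 2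

/-- `ℤ₂`-valued 1-chains on the links: a `Z`-error pattern modulo phases, link `ℓ` carrying
`n_E(ℓ) ∈ {0,1}` ("An error chain `E` … can be characterized by a function `n_E(ℓ)`").
[cite: DennisEtAl2002, §4.4 (n_E(ℓ) ∈ {0, 1})] -/
abbrev Chain : Type := Edge L → ZMod 2

/-- `ℤ₂`-valued 0-chains on the sites: syndromes of `Z`-errors (the sites `s` with `X_s = -1`).
[cite: DennisEtAl2002, §4.2 (outcome X_s = ±1 at each site)] -/
abbrev Syndrome : Type := Vertex L → ZMod 2

variable {L}

/-- The unit lattice vector `eᵢ` on the torus. [cite: DennisEtAl2002, §3.1] -/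
def dir (i : Fin 2) : Vertex L := Pi.single i 1

/-- The site (star) operator `X_s = ⊗_{ℓ ∋ s} X` as a binary row: the four link slots meeting the
site `s` — `(s, 0)`, `(s, 1)` leaving `s` and `(s - e₀, 0)`, `(s - e₁, 1)` arriving at `s` (summed in
`ℤ₂`, so coincident slots of the degenerate lattices `L ≤ 2` cancel correctly).
[cite: DennisEtAl2002, §3.1 (X_s = ⊗_{ℓ ∋ s} X_ℓ)] -/
def starRow (s : Vertex L) : Chain L :=
  Pi.single (s, 0) 1 + Pi.single (s, 1) 1 + Pi.single (s - dir 0, 0) 1 + Pi.single (s - dir 1, 1) 1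

/-- The plaquette operator `Z_P = ⊗_{ℓ ∈ ∂P} Z` as a binary row: the four links bounding the
plaquette with lower-left corner `w` — `(w, 0)`, `(w, 1)`, `(w + e₁, 0)`, `(w + e₀, 1)`.
[cite: DennisEtAl2002, §3.1 (Z_P = ⊗_{ℓ ∈ P} Z_ℓ)] -/
def plaquetteRow (w : Vertex L) : Chain L :=
  Pi.single (w, 0) 1 + Pi.single (w, 1) 1 + Pi.single (w + dir 1, 0) 1 + Pi.single (w + dir 0, 1) 1

variable (L)

/-- The `X`-type check matrix of the toric code: rows = sites, `(starMatrix L) s ℓ = 1` iff the link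
`ℓ` meets the site `s` (an odd number of times). [cite: DennisEtAl2002, §3.1 (site operators)] -/
def starMatrix : Matrix (Vertex L) (Edge L) (ZMod 2) :=
  Matrix.of fun s ℓ => starRow s ℓ

/-- The `Z`-type check matrix of the toric code: rows = plaquettes (labelled by their lower-left
site), entries the links on the plaquette boundary. [cite: DennisEtAl2002, §3.1 (plaquette operators)] -/
def plaquetteMatrix : Matrix (Vertex L) (Edge L) (ZMod 2) :=
  Matrix.of fun w ℓ => plaquetteRow w ℓ

variable {L}

/-- **Stars and plaquettes commute**: a site and a plaquette share an even number of links, i.e.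
`⟨X_s-row, Z_P-row⟩ = 0` in `ℤ₂` ("the site operators commute with the plaquette operators"; this is
`∂∂ = 0` for the cellular chain complex of the torus). [cite: DennisEtAl2002, §3.1 (X_s and Z_P commute)] -/
theorem starRow_dotProduct_plaquetteRow [NeZero L] (s w : Vertex L) : starRow s ⬝ᵥ plaquetteRow w = 0 := by
  simp only [starRow, plaquetteRow, add_dotProduct, single_dotProduct, one_mul, Pi.add_apply,
    Pi.single_apply, Prod.mk.injEq]
  simp only [Fin.isValue, and_true, one_ne_zero, and_false, if_false, add_zero, zero_ne_one,
    zero_add, sub_eq_iff_eq_add]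
  have h1 : w + dir 1 + dir 0 = w + dir 0 + dir 1 := add_right_comm _ _ _
  rw [h1]
  generalize (if s = w then (1 : ZMod 2) else 0) = a
  generalize (if s = w + dir 1 then (1 : ZMod 2) else 0) = b
  generalize (if s = w + dir 0 then (1 : ZMod 2) else 0) = c
  generalize (if s = w + dir 0 + dir 1 then (1 : ZMod 2) else 0) = d
  have h2 : (2 : ZMod 2) = 0 := by decide
  abel_nf
  simp [h2]

variable (L)

/-- `H^X (H^Z)ᵀ = 0` for the toric code (matrix form of `starRow_dotProduct_plaquetteRow`).
[cite: DennisEtAl2002, §3.1 (X_s and Z_P commute)] -/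
theorem starMatrix_mul_plaquetteMatrix_transpose [NeZero L] :
    starMatrix L * (plaquetteMatrix L)ᵀ = 0 := by
  ext s w
  simp only [starMatrix, plaquetteMatrix, mul_apply, transpose_apply, of_apply, Matrix.zero_apply]
  exact starRow_dotProduct_plaquetteRow s w

/-- **The toric code** as a CSS code (`CSS.lean`): `X`-checks at the sites, `Z`-checks at the
plaquettes, on the `2L²` link qubits. [cite: DennisEtAl2002, §3.1 (toric code)] -/
def toricCode [NeZero L] : CSSCode (Vertex L) (Vertex L) (Edge L) :=
  CSSCode.ofMatrices (starMatrix L) (plaquetteMatrix L) (starMatrix_mul_plaquetteMatrix_transpose L)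

/-! ### The decoding problem for `Z`-errors -/

/-- The syndrome of a `Z`-error chain `e`: the sites where `X_s` anticommutes with it, i.e. its
boundary `∂e = H^X e` ("the measured syndrome `S` reveals the boundary of the error chain `E`").
[cite: DennisEtAl2002, §4.3 (∂S = ∂E)] -/
def syn [NeZero L] (e : Chain L) : Syndrome L :=
  starMatrix L *ᵥ e

/-- The cycles (chains without boundary) = the `Z`-errors with trivial syndrome = the
undetectable errors `N`. [cite: DennisEtAl2002, §4.3 (E' = S + C', C' a cycle)] -/
def cycles [NeZero L] : Set (Chain L) :=
  {z | syn L z = 0}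

/-- The homologically trivial cycles: boundaries of 2-chains, i.e. the row space of the plaquette
matrix (products of plaquette operators = the `Z`-type stabilizer elements `S`). Recovery by `e'`
after the error `e` "will be successful" iff `e + e'` lies here.
[cite: DennisEtAl2002, §4.3 (C + C' homologically trivial: the boundary of a surface)] -/
def boundaries [NeZero L] : Set (Chain L) :=
  (rowSpace (plaquetteMatrix L) : Set (Chain L))

/-- A decoder for the `Z`-errors of the `L × L` toric code: syndrome (set of flagged sites) ↦
recovery chain (the tree's `Decoder`). The results below assume `Decoder.IsMinWeight D (syn L)
(cycles L) hammingNorm`: the recovery has the observed boundary and minimal length ("the single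
chain `E_min` … If the minimal chain is not unique, one of the minimal chains is selected"),
computable by minimum-weight perfect matching. [cite: DennisEtAl2002, §5.1 (E_min; Edmonds matching)] -/
abbrev ZDecoder : Type := Decoder (Syndrome L) (Chain L)

open Classical in
/-- **Failure probability** of the decoder `D` on the `L × L` toric code under independent
`Z`-errors of rate `p` with perfect syndrome measurement: the total probability
`Σ_{e : recovery fails} p^{|e|} (1-p)^{2L²-|e|}` of the error chains `e` for which `e + D(∂e)` is
homologically non-trivial ("Recovery succeeds if our hypothesis `E_min` is homologically
equivalent to the actual error chain `E` …, and fails otherwise").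
[cite: DennisEtAl2002, §5.2 (Prob_fail)] -/
noncomputable def failureProb [NeZero L] (D : ZDecoder L) (p : ℝ) : ℝ :=
  ∑ e ∈ univ.filter (fun e : Chain L => ¬ D.Corrects (syn L) (boundaries L) e),
    bernoulliWeight p (supp e)

/-! ### The counting hypothesis and the printed statements -/

/-- **Per-length exponential bound on self-avoiding walks** (the hypothesis shape fixed by
director-qec D4″): `cₙ ≤ C ν^n` for every `n`, where `cₙ = SAW.count n` is the number of `n`-step
self-avoiding walks on `ℤ²` from the origin (Literature/Probability/RandomPlanarGeometry, by name).
DKLP's elementary count "the first step … in any of `2d` directions, and each subsequent step in at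
most `2d-1`" is the instance `C = 4/3, ν = 3` (`SAW.Zd.count_succ_le`).
[cite: DennisEtAl2002, §5.3 eq. (saw_d)] -/
def SAWCountBound (C ν : ℝ) : Prop :=
  ∀ n : ℕ, (SAW.count n : ℝ) ≤ C * ν ^ n

/-- **Homologically non-trivial cycles are long**: every cycle of the `L × L` toric code that is
not a boundary has at least `L` links ("At a minimum, the homologically nontrivial (self-avoiding)
path must contain at least `L` links"), i.e. `d_Z ≥ L`. STATEMENT ONLY (Q5 proof obligation).
[cite: DennisEtAl2002, §5.2 (before eq. (saw_L))] -/
def cycle_weight_ge : Prop :=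
  ∀ (L : ℕ) [NeZero L] (z : Chain L), z ∈ cycles L → z ∉ boundaries L → L ≤ hammingNorm z

/-- **The Dennis–Kitaev–Landahl–Preskill threshold for the toric code with minimum-weight
decoding and perfect syndrome measurement, parametric in the walk-count bound** (director-qec
D4″). Printed: failure requires a homologically non-trivial self-avoiding polygon in `E + E_min`
with `H ≥ L` links, at least half of which carry errors, so
`Prob_fail ≤ L² Σ_{H ≥ L} n_SAP(H) (4p̃)^{H/2}`, `p̃ = p(1-p)` (eq. (saw_L) at `q = 0`), which
"rapidly approaches zero as `L` gets large" provided `p̃ < (4μ²)⁻¹` for an exponential growth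
rate `μ` of the polygon counts (eqs. (threshold_2d)–(p_c_2d), (fail_2d)). Typed form: for all
`C, ν` with `SAWCountBound C ν` (`∀ n, cₙ ≤ C ν^n`), every family `D L` of minimum-weight decoders
of the `(L+1) × (L+1)` toric codes, and every `0 ≤ p ≤ 1/2` with `4 ν² p(1-p) < 1`, the failure
probability tends to `0` as `L → ∞`. (No decay rate is asserted. The printed numerical corollary
"`p < .0373`" uses the ESTIMATE `μ₂ ≈ 2.638` and is a CLAIM only; certified instances live in
`Summits/Ventures/QEC/Thresholds/`.) STATEMENT ONLY — the Q5 proof target.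
[cite: DennisEtAl2002, §5.2–5.3 eqs. (saw_L), (threshold_2d), (fail_2d)] -/
def toricThreshold_of_sawCountBound : Prop :=
  ∀ (C ν : ℝ), 0 < ν → SAWCountBound C ν →
    ∀ (D : (L : ℕ) → ZDecoder (L + 1)),
      (∀ L, (D L).IsMinWeight (syn (L + 1)) (cycles (L + 1)) hammingNorm) →
        ∀ p : ℝ, 0 ≤ p → p ≤ 1 / 2 → 4 * ν ^ 2 * (p * (1 - p)) < 1 →
          Tendsto (fun L => failureProb (L + 1) (D L) p) atTop (𝓝 0)

/-- **Finite-size form** of the same bound with an explicit exponential rate (eq. (fail_2d):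
"`Prob_fail < Q₂(L,T) · (4μ₂² p̃)^{L/2}` where `Q₂(L,T)` is a polynomial"): under
`SAWCountBound C ν`, for `L ≥ 3`, a minimum-weight decoder and `0 ≤ p ≤ 1/2` with
`r := 2ν√(p(1-p)) < 1`, `failureProb L D p ≤ 2 L² · C · r^L / (ν (1 - r))` — the geometric tail
of `Σ_{H ≥ L} 2L² · c_{H-1} · (4p̃)^{H/2}` (`2L²` rooted starts, `c_{H-1} ≤ C ν^{H-1}`). STATEMENT ONLY (stronger than
`toricThreshold_of_sawCountBound`; the constant is ours, the shape is printed).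
[cite: DennisEtAl2002, §5.3 eq. (fail_2d)] -/
def failureProb_le_of_sawCountBound : Prop :=
  ∀ (C ν : ℝ), 0 < ν → SAWCountBound C ν →
    ∀ (L : ℕ) [NeZero L], 3 ≤ L → ∀ (D : ZDecoder L),
      D.IsMinWeight (syn L) (cycles L) hammingNorm →
        ∀ p : ℝ, 0 ≤ p → p ≤ 1 / 2 → 2 * ν * Real.sqrt (p * (1 - p)) < 1 →
          failureProb L D p ≤ 2 * (L : ℝ) ^ 2 * C * (2 * ν * Real.sqrt (p * (1 - p))) ^ L /
            (ν * (1 - 2 * ν * Real.sqrt (p * (1 - p))))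

/-! ### Error chains as vectors vs. error sets (appended 2026-08-26, qec-type-09)

`failureProb` sums over chains `e : Edge L → ZMod 2` weighted by `bernoulliWeight p (supp e)`; the
probabilistic lemmas of the tree (`ClusterCountingBound.lean`, the DKLP path-counting bounds) sum
over error SETS `E : Finset (Edge L)` weighted by `bernoulliWeight p E`. The two are the same sum
under the bijection `E ↦ 𝟙_E`, `e ↦ supp e` (PROVED below), so either form may be used. -/

/-- The indicator chain `𝟙_E` of a set of links (`n_E(ℓ) = 1` iff `ℓ ∈ E`).
[cite: DennisEtAl2002, §4.4 (n_E(ℓ) ∈ {0,1})] -/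
def chainOf (E : Finset (Edge L)) : Chain L :=
  fun ℓ => if ℓ ∈ E then 1 else 0

variable {L}

/-- Values in `ℤ₂` are `0` or `1`. [folklore] -/
private theorem zmod2_eq_one_of_ne_zero {a : ZMod 2} (h : a ≠ 0) : a = 1 := by
  revert a; decide

/-- `supp 𝟙_E = E`. [cite: DennisEtAl2002, §4.4 (n_E)] -/
theorem supp_chainOf [NeZero L] (E : Finset (Edge L)) : supp (chainOf L E) = E := by
  ext ℓ
  simp only [supp, chainOf, Finset.mem_filter, Finset.mem_univ, true_and]
  by_cases h : ℓ ∈ E <;> simp [h]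

/-- `𝟙_{supp e} = e`. [cite: DennisEtAl2002, §4.4 (n_E)] -/
theorem chainOf_supp [NeZero L] (e : Chain L) : chainOf L (supp e) = e := by
  funext ℓ
  simp only [chainOf, supp, Finset.mem_filter, Finset.mem_univ, true_and]
  by_cases h : e ℓ = 0
  · simp [h]
  · simp [zmod2_eq_one_of_ne_zero h]

variable (L)

open Classical in
/-- **`failureProb` as a sum over error sets**: `Prob_fail = Σ_{E ⊆ links : recovery fails on 𝟙_E}
p^{|E|} (1-p)^{2L²-|E|}` — the form consumed by the set-indexed counting lemmas
(`bernoulliWeight` on `Finset`). [cite: DennisEtAl2002, §5.2 (Prob_fail as a sum over error chains E)] -/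
theorem failureProb_eq_sum_sets [NeZero L] (D : ZDecoder L) (p : ℝ) :
    failureProb L D p =
      ∑ E ∈ univ.filter (fun E : Finset (Edge L) => ¬ D.Corrects (syn L) (boundaries L) (chainOf L E)),
        bernoulliWeight p E := by
  unfold failureProb
  refine Finset.sum_nbij' (fun e => supp e) (fun E => chainOf L E) ?_ ?_ ?_ ?_ ?_
  · intro e he
    simp only [Finset.mem_filter, Finset.mem_univ, true_and] at he ⊢
    rwa [chainOf_supp]
  · intro E hE
    simp only [Finset.mem_filter, Finset.mem_univ, true_and] at hE ⊢
    exact hE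
  · intro e _
    exact chainOf_supp e
  · intro E _
    exact supp_chainOf E
  · intro e _
    rfl

end ToricCode

end Literature.InformationTheory.QuantumCodes
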